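import Mathlib.Analysis.Convex.Cone.Dual
import Mathlib.Analysis.Calculus.Deriv.MeanValue
import Mathlib.Analysis.SpecialFunctions.ExpDeriv
import Summits.CriticalPhenomena.PercolationContinuityZ3.Theorems.PercNearOneGluingNoHeavyQuantGateCouplingMixture
import HarnessLib

/-!
# QUANT lane R8, T-DEC: THE OUTER-GATE FLOW — an abstract invariance lemma for closed convex cones along a differentiable path
# (`cone_flow_mem`), and the derivative of the gate in its parameter (`hasDerivAt_gate_apply`)

builds on p205010 (kernel theorem, internal audit signed; external expert review pending)

Support file (`--supports stmt-CriticalPhenomena-4575`), QUANT lane lead seat prim-quant-lead (gen 44); memo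
`run/shared/lean/prim/quant/prim-quant-lead-g44/LEAD-NOTES-G44.md` F1–F3, README V411.  Theorems only, standard axioms, no sorries.

THE ARCHITECTURE (LEAD-NOTES-G44 F1).  The open core of R8-light is the sibling step (`LawDec.SiblingStep`, ✓ p396424): SDEC of a forest
`F_q = ∗ⱼ gate_{qⱼ} ρⱼ` of `k ≥ 3` composite sibling trees, i.e. membership of `gate_{a′} F_q` in the cone `C` of laws that are DEC at floor `a′·x`
and target `S = a′·Σ qⱼRⱼ` at every layer — a CLOSED convex cone (✓ p395585, `isClosed_decGraph`).  Every explicit certificate of the lane (two-root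
✓ p392934, cherry ✓ p396159, identity I ✓ p395998, atomic ✓ p396731/⧗ p396984) writes `gate_{a′} F_q` as ONE finite mixture whose bulk is the ungated
product at smaller root gates.  THE FLOW replaces the one-step mixture by a differential one: along any C¹ path `t ↦ (b(t), p(t))` of (outer gate,
root gates) ending at `(a′, q)` and starting at an ungated product (`b = 1`, a member of `C` by `convClosedT_holds`), the law `G(t) = gate_{b} F_p`
satisfies — because `gate` is affine in its parameter (`hasDerivAt_gate_apply` below) and `lconv` is bilinear —
  `G′ = [ḃ − Σⱼ βⱼ]·F_p + Σⱼ βⱼ·starⱼ(p) − ḃ·δ₀`,  `βⱼ = b·ṗⱼ/(1−pⱼ)`,  `starⱼ(p) = ρⱼ ∗ F_{p,−j}` (box `j` opened),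
so that `G′ + κ·G` is an EXPLICIT first-order combination of the ungated product, the `k` opened stars and `δ₀`.  The abstract lemma
`cone_flow_mem` below (integrating factor `e^{K}`, `K′ = κ`; separation `ProperCone.hyperplane_separation_point`; monotonicity from the sign of
the derivative) then says: **if `G′(t) + κ(t)·G(t) ∈ C` along the path and `G(0) ∈ C`, then `G(1) ∈ C`** — the product bulk is carried by the
integrating factor and is never certified; only the first-order 'opened star + δ₀' measures are.  For `k = 2` the flow integrates to the two-root
identity (the emitted component is arm-1's chain).  HONEST STATUS (README V411 F3, kit ✓ j236916, exact LPs on 300 generic three-2-chain groups):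
at pattern level the linearised problem and the one-step problem have IDENTICAL feasible sets (292 = 292) — the flow is a k-general bookkeeping
device, not a way around the pinned near-tie core of the light half; `SiblingStep`, `GateStepN`, `Quant.FarTreeRow` remain OPEN; the RATE class
(log\*) and the honest sentence of `run/shared/lean/prim/quant/README.md` are unchanged.  The instantiation of `C` as a `ProperCone` of law
vectors (from `isClosed_decGraph` + `decAtT_mixture`) is left to the typer (LEAD-NOTES-G44 F5).

* `cone_flow_mem` — closed convex cone invariance along a path: `G(a) ∈ C`, `G′ + κG ∈ C` on `[a,b]` ⟹ `G(b) ∈ C` (no sign condition on `κ`).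
* `cone_flow_mem_of_nonneg_comb` — the same with the hypothesis in the form the certificates produce it: `G′(t) + κ(t)G(t) = Σᵢ wᵢ(t)·Hᵢ(t)` with
  `wᵢ ≥ 0`, `Hᵢ(t) ∈ C`.
* `hasDerivAt_gate_apply` — `q ↦ gate μ q h` has derivative `μ h − δ₀ h`; `gate_sub_gate` — `gate μ q − gate μ q′ = (q − q′)·(μ − δ₀)` pointwise;
  `hasDerivAt_lconv_gate_right` — OPENING A ROOT GATE: `q ↦ (μ ∗ gate_q ν) h` has derivative `(μ ∗ ν) h − μ h` ('opened star minus the forest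
  without the box', arm-1 g45's `lconv_gate_right`), the algebraic input of the local target `M(t)` above.

[this work].  Nothing here is cited as a published result.  The gluing rows served [cite: KozmaNitzan2024, Conjecture 3 (p. 15)]; product measure
[cite: Grimmett1999, §1.3 p. 10].
-/

noncomputable section

namespace Summit.CriticalPhenomena.PercolationContinuityZ3.Theorems

namespace Quant

namespace LawDec

open Set

/-! ### The abstract flow lemma -/

/-- **FLOW LEMMA (closed convex cone invariance along a differentiable path).**  `C` a proper (closed, convex, pointed) cone in a real normed
space, `G` a path with derivative `G′`, `K` a real function with derivative `κ` (an integrating-factor exponent; no sign condition).  If `G a ∈ C`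
and `G′ t + κ t • G t ∈ C` for every `t ∈ [a, b]`, then `G b ∈ C`.  Proof: for a separating functional `f ≥ 0` on `C` with `f (G b) < 0`, the real
function `t ↦ e^{K t}·f (G t)` has nonnegative derivative `e^{K t}·f (G′ t + κ t • G t)` on `[a,b]`, is `≥ 0` at `a` and `< 0` at `b` — impossible.
[this work] -/
theorem cone_flow_mem {E : Type*} [NormedAddCommGroup E] [NormedSpace ℝ E] (C : ProperCone ℝ E)
    {G G' : ℝ → E} {K κ : ℝ → ℝ} {a b : ℝ} (hab : a ≤ b)
    (hG : ∀ t, HasDerivAt G (G' t) t) (hK : ∀ t, HasDerivAt K (κ t) t)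
    (hC : ∀ t ∈ Icc a b, G' t + κ t • G t ∈ C) (h0 : G a ∈ C) : G b ∈ C := by
  by_contra hb
  obtain ⟨f, hfC, hfb⟩ := C.hyperplane_separation_point hb
  let φ : ℝ → ℝ := fun t => Real.exp (K t) * f (G t)
  have hφ' : ∀ t, HasDerivAt φ (Real.exp (K t) * f (G' t + κ t • G t)) t := by
    intro t
    have h1 : HasDerivAt (fun t => Real.exp (K t)) (Real.exp (K t) * κ t) t := (hK t).exp
    have h2 : HasDerivAt (fun t => f (G t)) (f (G' t)) t := f.hasFDerivAt.comp_hasDerivAt t (hG t)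
    refine (h1.mul h2).congr_deriv ?_
    rw [map_add, map_smul, smul_eq_mul]
    ring
  have hmono : MonotoneOn φ (Icc a b) := by
    refine monotoneOn_of_hasDerivWithinAt_nonneg (convex_Icc a b) (fun t _ => (hφ' t).continuousAt.continuousWithinAt)
      (fun t _ => (hφ' t).hasDerivWithinAt) (fun t ht => ?_)
    rw [interior_Icc] at ht
    exact mul_nonneg (Real.exp_pos _).le (hfC _ (hC t (Ioo_subset_Icc_self ht)))
  have hle : φ a ≤ φ b := hmono (left_mem_Icc.2 hab) (right_mem_Icc.2 hab) hab
  have ha0 : 0 ≤ φ a := mul_nonneg (Real.exp_pos _).le (hfC _ h0)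
  have hb0 : φ b < 0 := mul_neg_of_pos_of_neg (Real.exp_pos _) hfb
  linarith

/-- **FLOW LEMMA, certificate form.**  If along `[a,b]` the first-order measure `G′ t + κ t • G t` is an explicit nonnegative combination
`Σᵢ wᵢ t • Hᵢ t` of members `Hᵢ t ∈ C` (finitely many component families `i`), and `G a ∈ C`, then `G b ∈ C`. [this work] -/
theorem cone_flow_mem_of_nonneg_comb {E : Type*} [NormedAddCommGroup E] [NormedSpace ℝ E] (C : ProperCone ℝ E)
    {ι : Type*} (s : Finset ι) {G G' : ℝ → E} {K κ : ℝ → ℝ} {w : ι → ℝ → ℝ} {H : ι → ℝ → E} {a b : ℝ} (hab : a ≤ b)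
    (hG : ∀ t, HasDerivAt G (G' t) t) (hK : ∀ t, HasDerivAt K (κ t) t)
    (hw : ∀ t ∈ Icc a b, ∀ i ∈ s, 0 ≤ w i t) (hH : ∀ t ∈ Icc a b, ∀ i ∈ s, H i t ∈ C)
    (hsum : ∀ t ∈ Icc a b, G' t + κ t • G t = ∑ i ∈ s, w i t • H i t) (h0 : G a ∈ C) : G b ∈ C := by
  classical
  refine cone_flow_mem C hab hG hK (fun t ht => ?_) h0
  rw [hsum t ht]
  -- a nonnegative combination of members of a pointed convex cone is a member
  have key : ∀ s' : Finset ι, (∀ i ∈ s', 0 ≤ w i t) → (∀ i ∈ s', H i t ∈ C) → ∑ i ∈ s', w i t • H i t ∈ C := by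
    intro s'
    induction s' using Finset.induction_on with
    | empty => intro _ _; simp
    | @insert i s' hi ih =>
      intro hw' hH'
      rw [Finset.sum_insert hi]
      exact C.add_mem (C.smul_mem (hH' i (Finset.mem_insert_self i s')) (hw' i (Finset.mem_insert_self i s')))
        (ih (fun i' hi' => hw' i' (Finset.mem_insert_of_mem hi')) (fun i' hi' => hH' i' (Finset.mem_insert_of_mem hi')))
  exact key s (hw t ht) (hH t ht)

/-! ### The gate is affine in its parameter -/

/-- **derivative of the gate in its parameter**: `q ↦ gate μ q h` has derivative `μ h − δ₀ h` (the gate is affine: `gate μ q = δ₀ + q·(μ − δ₀)`).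
[this work] -/
theorem hasDerivAt_gate_apply (μ : ℕ → ℝ) (h : ℕ) (q : ℝ) :
    HasDerivAt (fun q' => gate μ q' h) (μ h - (if h = 0 then (1 : ℝ) else 0)) q := by
  have e : (fun q' => gate μ q' h) = fun q' => q' * (μ h - (if h = 0 then (1 : ℝ) else 0)) + (if h = 0 then (1 : ℝ) else 0) := by
    funext q'
    simp only [gate]
    split_ifs <;> ring
  rw [e]
  have := ((hasDerivAt_id q).mul_const (μ h - (if h = 0 then (1 : ℝ) else 0))).add_const (if h = 0 then (1 : ℝ) else 0)
  simpa using this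

/-- **the gate is affine**: `gate μ q h − gate μ q′ h = (q − q′)·(μ h − δ₀ h)`. [this work] -/
theorem gate_sub_gate (μ : ℕ → ℝ) (q q' : ℝ) (h : ℕ) :
    gate μ q h - gate μ q' h = (q - q') * (μ h - (if h = 0 then (1 : ℝ) else 0)) := by
  simp only [gate]
  split_ifs <;> ring

/-- **opening a root gate**: for `μ` vanishing above `M₁`, `q ↦ (μ ∗ gate_q ν) h` has derivative `(μ ∗ ν) h − μ h` — the opened star minus the
forest without the box (`lconv_gate_right`: `μ ∗ gate_q ν = q·(μ ∗ ν) + (1−q)·μ`). [this work] -/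
theorem hasDerivAt_lconv_gate_right (M₁ M₂ : ℕ) (μ ν : ℕ → ℝ) (hμM : ∀ h, M₁ < h → μ h = 0) (h : ℕ) (q : ℝ) :
    HasDerivAt (fun q' => lconv M₁ M₂ μ (gate ν q') h) (lconv M₁ M₂ μ ν h - μ h) q := by
  have e : (fun q' => lconv M₁ M₂ μ (gate ν q') h) = fun q' => q' * (lconv M₁ M₂ μ ν h - μ h) + μ h := by
    funext q'
    rw [lconv_gate_right M₁ M₂ μ ν q' hμM h]
    ring
  rw [e]
  have := ((hasDerivAt_id q).mul_const (lconv M₁ M₂ μ ν h - μ h)).add_const (μ h)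
  simpa using this

end LawDec

end Quant

end Summit.CriticalPhenomena.PercolationContinuityZ3.Theorems
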